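import Literature.MathematicalPhysics.QuantumLattice.YangMillsHeatFlowDivGradientBochner
import Literature.MathematicalPhysics.QuantumLattice.YangMillsHeatFlowScalarEnergy
import HarnessLib

/-!
# The localized space-time `L²` bound for `∇_A D^*F` along the Yang–Mills heat flow

QuantumLattice support file (everything proved; no definitions, no named facts) on the proof
path of `Literature.MathematicalPhysics.QuantumLattice.Waldron2019_yangMillsFlow_flatTorus`
(A. Waldron, Invent. math. 217 (2019)), §3: the energy-estimate half of the `k = 1` case of the
`D^*F` estimate in Prop. 3.1(b). With `𝒟ⱼ = div F(bⱼ)`, `u = ∑ⱼ‖𝒟ⱼ‖²`, `H = ∑_{lj}‖D_l𝒟ⱼ‖²`,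
integrating the identity `∂ₜu − Δu = −2H + 4∑⟨𝒟ⱼ,[F_{ji},𝒟ᵢ]⟩ ≤ −2H + A₄√e u`
(`deriv_divDensity_sub_laplacian_le`) against `φ²` and by parts
(`∫φ²Δu ≤ ∫φ²H + 4∫u‖∇φ‖²`, Kato `‖∇u‖² ≤ 4uH`):

* `norm_fderiv_divDensity_sq_le` — the Kato-type bound `‖∇u‖² ≤ 4 u H`;
* `integral_sq_mul_laplacian_divDensity_le` — `∫ φ²Δu ≤ ∫ (φ²H + 4u‖∇φ‖²)`;
* `integral_sq_mul_divGradDensity_le_of_flow_on` — fixed time: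
  `∫φ²H ≤ −∫φ²∂ₜu + 4K²∫_U u + A₄S∫φ²u`;
* `intervalIntegral_integral_sq_mul_divGradDensity_le` — **the space-time bound**
  `∫_{t₁}^{t₂}∫φ²H ≤ ∫φ²u(t₁) + 4K²∫_{t₁}^{t₂}∫_U u + A₄S∫_{t₁}^{t₂}∫φ²u`.

References: A. Waldron, Invent. math. 217 (2019), Prop. 3.1(b) [Waldron2019]; A. Waldron,
Calc. Var. PDE 55 (2016), Lemma 3.5 [Waldron2016].
-/

noncomputable section

open scoped ContDiff Topology RealInnerProductSpace Matrix NNReal ENNReal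
open Set Filter MeasureTheory Metric

namespace Literature.MathematicalPhysics.QuantumLattice

section DivGradEnergy

open scoped Matrix.Norms.Frobenius

attribute [local instance] frobeniusInnerProductSpace

variable {m : Type*} [Fintype m] [DecidableEq m]
variable {E : Type*} [NormedAddCommGroup E] [InnerProductSpace ℝ E] [FiniteDimensional ℝ E]
  [MeasurableSpace E] [BorelSpace E]
variable {ι : Type*} [Fintype ι] [LinearOrder ι]

/-- Finite differentiability orders are below `∞`. [folklore] -/
private theorem natCast_le_infty₁₁ (n : ℕ) : (n : WithTop ℕ∞) ≤ (⊤ : ℕ∞) := by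
  exact_mod_cast le_top

omit [MeasurableSpace E] [BorelSpace E] [LinearOrder ι] [Fintype ι] in
/-- **Joint smoothness of the covariant derivatives of `D^*F`**: `(t, y) ↦ D_w 𝒟_v(t)(y)` is
smooth on `𝒯 × E` for a jointly smooth `A` (`𝒯` open). [folklore] -/
theorem contDiffOn_covDeriv_divCurvature_joint {A : ℝ → Connection E (Matrix m m ℂ)} {𝒯 : Set ℝ}
    (h𝒯 : IsOpen 𝒯) (hA : ContDiffOn ℝ ∞ (fun p : ℝ × E => A p.1 p.2) (𝒯 ×ˢ (univ : Set E)))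
    (v w : E) :
    ContDiffOn ℝ ∞ (fun p : ℝ × E =>
      covDeriv (A p.1) (fun z => divCurvature (A p.1) z v) p.2 w) (𝒯 ×ˢ (univ : Set E)) := by
  have hO : IsOpen (𝒯 ×ˢ (univ : Set E)) := h𝒯.prod isOpen_univ
  have hΦ := contDiffOn_divCurvature_joint h𝒯 hA v
  have hΦ' : ContDiffOn ℝ ∞ (fun p : ℝ × E =>
      fderiv ℝ (fun p : ℝ × E => divCurvature (A p.1) p.2 v) p ((0 : ℝ), w))
      (𝒯 ×ˢ (univ : Set E)) :=
    ((hΦ.fderiv_of_isOpen hO (m := ∞) (by norm_cast)).clm_apply contDiffOn_const)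
  have hAw : ContDiffOn ℝ ∞ (fun p : ℝ × E => A p.1 p.2 w) (𝒯 ×ˢ (univ : Set E)) :=
    hA.clm_apply contDiffOn_const
  have hbr : ContDiffOn ℝ ∞ (fun p : ℝ × E => ⁅A p.1 p.2 w, divCurvature (A p.1) p.2 v⁆)
      (𝒯 ×ˢ (univ : Set E)) := by
    have h := (hAw.mul hΦ).sub (hΦ.mul hAw)
    simp only [Ring.lie_def]
    exact h
  refine (hΦ'.add hbr).congr fun p hp => ?_
  obtain ⟨t, y⟩ := p
  change covDeriv (A t) (fun z => divCurvature (A t) z v) y w = _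
  unfold covDeriv
  rw [fderiv_spaceSlice_apply hO hΦ (by simp) hp w]
  rfl

omit [MeasurableSpace E] [BorelSpace E] [LinearOrder ι] in
/-- **Kato-type bound for `u = |D^*F|²`**: for a `C³` `𝔲(m)`-valued connection,
`‖∇u‖² ≤ 4 u H` with `u = ∑ⱼ‖𝒟ⱼ‖²`, `H = ∑_{lj}‖D_l𝒟ⱼ‖²` (`∂_l u = 2∑ⱼ⟨𝒟ⱼ, D_l𝒟ⱼ⟩` and
Cauchy–Schwarz). [folklore] -/
theorem norm_fderiv_divDensity_sq_le (b : OrthonormalBasis ι ℝ E)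
    {A : Connection E (Matrix m m ℂ)} (hA : ContDiff ℝ 3 A)
    (hval : A.IsValuedIn (skewAdjoint.submodule ℝ (Matrix m m ℂ))) (y : E) :
    ‖fderiv ℝ (fun z => ∑ j, ‖divCurvature A z (b j)‖ ^ 2) y‖ ^ 2 ≤
      4 * (∑ j, ‖divCurvature A y (b j)‖ ^ 2) *
        ∑ l, ∑ j, ‖covDeriv A (fun z => divCurvature A z (b j)) y (b l)‖ ^ 2 := by
  have hA12 : ContDiff ℝ (1 + 2) A := by rw [show (1 : WithTop ℕ∞) + 2 = 3 by norm_num]; exact hA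
  have hDd : ∀ j, Differentiable ℝ fun z => divCurvature A z (b j) := fun j =>
    (contDiff_divCurvature_apply hA12 (b j)).differentiable one_ne_zero
  rw [← sum_sq_apply_orthonormalBasis_eq b, Finset.mul_sum]
  refine Finset.sum_le_sum fun l _ => ?_
  have hdl : fderiv ℝ (fun z => ∑ j, ‖divCurvature A z (b j)‖ ^ 2) y (b l) =
      ∑ j, 2 * ⟪divCurvature A y (b j), covDeriv A (fun z => divCurvature A z (b j)) y (b l)⟫ := by
    rw [fderiv_fun_sum fun j _ => ((hDd j) y).norm_sq ℝ, FunLike.coe_sum, Finset.sum_apply]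
    exact Finset.sum_congr rfl fun j _ =>
      fderiv_norm_sq_eq_two_inner_covDeriv ((hDd j) y) (b l) (hval y (b l))
  rw [hdl]
  set D : ι → Matrix m m ℂ := fun j => divCurvature A y (b j) with hD
  set G : ι → Matrix m m ℂ := fun j => covDeriv A (fun z => divCurvature A z (b j)) y (b l) with hG
  have hcs : |∑ j, ⟪D j, G j⟫| ≤ Real.sqrt (∑ j, ‖D j‖ ^ 2) * Real.sqrt (∑ j, ‖G j‖ ^ 2) := by
    have h1 : |∑ j, ⟪D j, G j⟫| ≤ ∑ j, ‖D j‖ * ‖G j‖ :=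
      (Finset.abs_sum_le_sum_abs _ _).trans (Finset.sum_le_sum fun j _ => abs_real_inner_le_norm _ _)
    have h2 := Real.sum_mul_le_sqrt_mul_sqrt Finset.univ (fun j => ‖D j‖) (fun j => ‖G j‖)
    exact h1.trans h2
  have hD0 : 0 ≤ ∑ j, ‖D j‖ ^ 2 := Finset.sum_nonneg fun j _ => sq_nonneg _
  have hG0 : 0 ≤ ∑ j, ‖G j‖ ^ 2 := Finset.sum_nonneg fun j _ => sq_nonneg _
  have hsum : ∑ j, 2 * ⟪D j, G j⟫ = 2 * ∑ j, ⟪D j, G j⟫ := by rw [Finset.mul_sum]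
  rw [hsum]
  have h' := pow_le_pow_left₀ (abs_nonneg _) hcs 2
  rw [sq_abs, mul_pow, Real.sq_sqrt hD0, Real.sq_sqrt hG0] at h'
  calc (2 * ∑ j, ⟪D j, G j⟫) ^ 2 = 4 * (∑ j, ⟪D j, G j⟫) ^ 2 := by ring
    _ ≤ 4 * ((∑ j, ‖D j‖ ^ 2) * ∑ j, ‖G j‖ ^ 2) := by gcongr
    _ = 4 * (∑ j, ‖D j‖ ^ 2) * ∑ j, ‖G j‖ ^ 2 := by ring

omit [LinearOrder ι] in
/-- **`∫ φ² Δu ≤ ∫ (φ² H + 4 u ‖∇φ‖²)`** for `u = |D^*F|²` of a smooth `𝔲(m)`-valued connection and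
`φ ∈ C¹_c` (integration by parts once, Kato `‖∇u‖ ≤ 2√u√H`, and `4|φ|√H ‖∇φ‖√u ≤ φ²H + 4‖∇φ‖²u`).
[folklore] -/
theorem integral_sq_mul_laplacian_divDensity_le (b : OrthonormalBasis ι ℝ E)
    {A : Connection E (Matrix m m ℂ)} (hA : ContDiff ℝ ∞ A)
    (hval : A.IsValuedIn (skewAdjoint.submodule ℝ (Matrix m m ℂ)))
    {φ : E → ℝ} (hφ : ContDiff ℝ 1 φ) (hφc : HasCompactSupport φ) :
    ∫ y, φ y ^ 2 * ∑ l, fderiv ℝ (fun z => fderiv ℝ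
        (fun x => ∑ j, ‖divCurvature A x (b j)‖ ^ 2) z (b l)) y (b l) ≤
      ∫ y, (φ y ^ 2 * ∑ l, ∑ j, ‖covDeriv A (fun z => divCurvature A z (b j)) y (b l)‖ ^ 2 +
        4 * (∑ j, ‖divCurvature A y (b j)‖ ^ 2) * ‖fderiv ℝ φ y‖ ^ 2) := by
  have hA1 : ContDiff ℝ 1 A := hA.of_le (natCast_le_infty₁₁ 1)
  have hA3 : ContDiff ℝ 3 A := hA.of_le (natCast_le_infty₁₁ 3)
  have hA22 : ContDiff ℝ (2 + 2) A := by
    rw [show (2 : WithTop ℕ∞) + 2 = 4 by norm_num]; exact hA.of_le (natCast_le_infty₁₁ 4)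
  have hA32 : ContDiff ℝ (3 + 2) A := by
    rw [show (3 : WithTop ℕ∞) + 2 = 5 by norm_num]; exact hA.of_le (natCast_le_infty₁₁ 5)
  have hD2 : ∀ j, ContDiff ℝ 2 fun z => divCurvature A z (b j) := fun j =>
    contDiff_divCurvature_apply hA22 (b j)
  have hu2 : ContDiff ℝ 2 fun x => ∑ j, ‖divCurvature A x (b j)‖ ^ 2 :=
    ContDiff.sum fun j _ => (hD2 j).norm_sq ℝ
  have hf : ∀ l, ContDiff ℝ 1 fun z => fderiv ℝ (fun x => ∑ j, ‖divCurvature A x (b j)‖ ^ 2) z (b l) :=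
    fun l => (hu2.fderiv_right (m := 1) (by norm_num)).clm_apply contDiff_const
  set u : E → ℝ := fun x => ∑ j, ‖divCurvature A x (b j)‖ ^ 2 with hu
  set H : E → ℝ := fun y => ∑ l, ∑ j, ‖covDeriv A (fun z => divCurvature A z (b j)) y (b l)‖ ^ 2
    with hH
  have hHc : Continuous H := by
    refine continuous_finsetSum _ fun l _ => continuous_finsetSum _ fun j _ => ?_
    have h21 : ContDiff ℝ (2 + 1) fun z => divCurvature A z (b j) := by
      rw [show (2 : WithTop ℕ∞) + 1 = 3 by norm_num]; exact contDiff_divCurvature_apply hA32 (b j)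
    exact ((contDiff_covDeriv_apply (hA.of_le (natCast_le_infty₁₁ 2)) h21 (b l)).continuous).norm.pow 2
  have hH0 : ∀ y, 0 ≤ H y := fun y => Finset.sum_nonneg fun l _ => Finset.sum_nonneg fun j _ =>
    sq_nonneg _
  have hu0 : ∀ y, 0 ≤ u y := fun y => Finset.sum_nonneg fun j _ => sq_nonneg _
  have huc : Continuous u := hu2.continuous
  -- the test function `χ = φ²`
  have hχ : ContDiff ℝ 1 fun y => φ y ^ 2 := hφ.pow 2
  have hχc : HasCompactSupport fun y => φ y ^ 2 := hasCompactSupport_sq hφc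
  have hdχ : ∀ y i, fderiv ℝ (fun y => φ y ^ 2) y (b i) = 2 * φ y * fderiv ℝ φ y (b i) := by
    intro y i
    rw [((hφ.differentiable one_ne_zero y).hasFDerivAt.pow 2).fderiv]
    simp only [smul_apply, nsmul_eq_mul, Nat.cast_ofNat, smul_eq_mul, Nat.add_one_sub_one, pow_one]
  -- integration by parts
  rw [integral_mul_sum_fderiv_eq_neg_integral (fun i => b i) hχ hχc hf]
  simp_rw [hdχ]
  rw [← integral_neg]
  -- pointwise bound on the flux
  have hpt : ∀ y, -(∑ i, fderiv ℝ u y (b i) * (2 * φ y * fderiv ℝ φ y (b i))) ≤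
      φ y ^ 2 * H y + 4 * u y * ‖fderiv ℝ φ y‖ ^ 2 := by
    intro y
    have hsum : ∑ i, fderiv ℝ u y (b i) * (2 * φ y * fderiv ℝ φ y (b i)) =
        2 * φ y * ∑ i, fderiv ℝ u y (b i) * fderiv ℝ φ y (b i) := by
      rw [Finset.mul_sum]
      exact Finset.sum_congr rfl fun i _ => by ring
    have hcs : |∑ i, fderiv ℝ u y (b i) * fderiv ℝ φ y (b i)| ≤ ‖fderiv ℝ u y‖ * ‖fderiv ℝ φ y‖ := by
      have h := Real.sum_mul_le_sqrt_mul_sqrt Finset.univ (fun i => fderiv ℝ u y (b i))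
        (fun i => fderiv ℝ φ y (b i))
      have h' := Real.sum_mul_le_sqrt_mul_sqrt Finset.univ (fun i => -fderiv ℝ u y (b i))
        (fun i => fderiv ℝ φ y (b i))
      simp only [neg_mul, Finset.sum_neg_distrib, even_two, Even.neg_pow] at h'
      rw [sum_sq_apply_orthonormalBasis_eq b, sum_sq_apply_orthonormalBasis_eq b,
        Real.sqrt_sq (norm_nonneg _), Real.sqrt_sq (norm_nonneg _)] at h h'
      exact abs_le.mpr ⟨by linarith, h⟩
    have hkato : ‖fderiv ℝ u y‖ ≤ 2 * Real.sqrt (u y) * Real.sqrt (H y) := by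
      have h := norm_fderiv_divDensity_sq_le b hA3 hval y
      have h4 : 4 * u y * H y = (2 * Real.sqrt (u y) * Real.sqrt (H y)) ^ 2 := by
        rw [mul_pow, mul_pow, Real.sq_sqrt (hu0 y), Real.sq_sqrt (hH0 y)]; ring
      have h' : ‖fderiv ℝ u y‖ ^ 2 ≤ (2 * Real.sqrt (u y) * Real.sqrt (H y)) ^ 2 := by
        rw [← h4]; exact h
      exact (pow_le_pow_iff_left₀ (norm_nonneg _) (by positivity) two_ne_zero).mp h'
    have hyoung : 2 * |φ y| * ‖fderiv ℝ φ y‖ * (2 * Real.sqrt (u y) * Real.sqrt (H y)) ≤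
        φ y ^ 2 * H y + 4 * u y * ‖fderiv ℝ φ y‖ ^ 2 := by
      have hsq := sq_nonneg (|φ y| * Real.sqrt (H y) - 2 * (‖fderiv ℝ φ y‖ * Real.sqrt (u y)))
      have e1 : (|φ y| * Real.sqrt (H y)) ^ 2 = φ y ^ 2 * H y := by
        rw [mul_pow, sq_abs, Real.sq_sqrt (hH0 y)]
      have e2 : (‖fderiv ℝ φ y‖ * Real.sqrt (u y)) ^ 2 = u y * ‖fderiv ℝ φ y‖ ^ 2 := by
        rw [mul_pow, Real.sq_sqrt (hu0 y)]; ring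
      nlinarith [hsq, e1, e2]
    rw [hsum]
    calc -(2 * φ y * ∑ i, fderiv ℝ u y (b i) * fderiv ℝ φ y (b i))
        ≤ |2 * φ y * ∑ i, fderiv ℝ u y (b i) * fderiv ℝ φ y (b i)| := neg_le_abs _
      _ = 2 * |φ y| * |∑ i, fderiv ℝ u y (b i) * fderiv ℝ φ y (b i)| := by
          rw [abs_mul, abs_mul, abs_two]
      _ ≤ 2 * |φ y| * (‖fderiv ℝ u y‖ * ‖fderiv ℝ φ y‖) :=
          mul_le_mul_of_nonneg_left hcs (by positivity)
      _ ≤ 2 * |φ y| * (2 * Real.sqrt (u y) * Real.sqrt (H y) * ‖fderiv ℝ φ y‖) := by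
          gcongr
      _ = 2 * |φ y| * ‖fderiv ℝ φ y‖ * (2 * Real.sqrt (u y) * Real.sqrt (H y)) := by ring
      _ ≤ φ y ^ 2 * H y + 4 * u y * ‖fderiv ℝ φ y‖ ^ 2 := hyoung
  -- integrability and conclusion
  have hdφc : ∀ i, Continuous fun y => fderiv ℝ φ y (b i) := fun i =>
    (hφ.continuous_fderiv one_ne_zero).clm_apply continuous_const
  have hduc : ∀ i, Continuous fun y => fderiv ℝ u y (b i) := fun i => (hf i).continuous
  have hI1 : Integrable fun y => -(∑ i, fderiv ℝ u y (b i) * (2 * φ y * fderiv ℝ φ y (b i))) := by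
    refine Integrable.neg (integrable_finsetSum _ fun i _ => ?_)
    have hc : Continuous fun y => fderiv ℝ u y (b i) * (2 * φ y * fderiv ℝ φ y (b i)) :=
      (hduc i).mul ((continuous_const.mul hφ.continuous).mul (hdφc i))
    exact hc.integrable_of_hasCompactSupport
      (((hφc.fderiv_apply (𝕜 := ℝ) (b i)).mul_left).mul_left)
  have hI2 : Integrable fun y => φ y ^ 2 * H y + 4 * u y * ‖fderiv ℝ φ y‖ ^ 2 := by
    refine Integrable.add ?_ ?_
    · exact ((hφ.continuous.pow 2).mul hHc).integrable_of_hasCompactSupport hχc.mul_right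
    · have hc : Continuous fun y => 4 * u y * ‖fderiv ℝ φ y‖ ^ 2 :=
        (continuous_const.mul huc).mul ((hφ.continuous_fderiv one_ne_zero).norm.pow 2)
      exact hc.integrable_of_hasCompactSupport
        (hasCompactSupport_norm_sq (hφc.fderiv (𝕜 := ℝ))).mul_left
  exact integral_mono hI1 hI2 hpt

/-- **The fixed-time inequality for `H = |∇D^*F|²`.** Along a jointly smooth `𝔲(m)`-valued
solution of the Yang–Mills heat equation on the open time set `𝒯 ∋ t`, for a `C¹` compactly
supported `φ` with `‖∇φ‖ ≤ K`, `∇φ = 0` off the measurable `U ⊆ K_c` (compact) and `√e(t) ≤ S`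
on `{φ ≠ 0}`: with `u = ∑‖𝒟ⱼ‖²`, `H = ∑‖D_l𝒟ⱼ‖²`, `A₄ = 8√2 (card ι)`,
`∫ φ²H(t) ≤ −∫ φ² ∂ₜu(t) + 4K² ∫_U u(t) + A₄S ∫ φ²u(t)`.
[cite: Waldron2019, Prop. 3.1(b) (k = 1); Waldron2016, Lemma 3.5] -/
theorem integral_sq_mul_divGradDensity_le_of_flow_on (b : OrthonormalBasis ι ℝ E)
    {A : ℝ → Connection E (Matrix m m ℂ)} {𝒯 : Set ℝ} (h𝒯 : IsOpen 𝒯)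
    (hA : ContDiffOn ℝ ∞ (fun p : ℝ × E => A p.1 p.2) (𝒯 ×ˢ (univ : Set E)))
    (hval : ∀ ⦃s : ℝ⦄, s ∈ 𝒯 → (A s).IsValuedIn (skewAdjoint.submodule ℝ (Matrix m m ℂ)))
    (hpde : ∀ ⦃s : ℝ⦄, s ∈ 𝒯 → ∀ y w, deriv (fun s' => A s' y w) s = divCurvature (A s) y w)
    {φ : E → ℝ} (hφ : ContDiff ℝ 1 φ) (hφc : HasCompactSupport φ)
    {Kc U : Set E} (hKc : IsCompact Kc) (hUK : U ⊆ Kc) (hU : MeasurableSet U)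
    (hφU : ∀ y ∉ U, fderiv ℝ φ y = 0) {K : ℝ} (hK : ∀ y, ‖fderiv ℝ φ y‖ ≤ K)
    {t : ℝ} (ht : t ∈ 𝒯) {S : ℝ}
    (hS : ∀ y, φ y ≠ 0 → Real.sqrt (ymDensityOfBasis b (A t) y) ≤ S) :
    ∫ y, φ y ^ 2 * ∑ l, ∑ j, ‖covDeriv (A t) (fun z => divCurvature (A t) z (b j)) y (b l)‖ ^ 2 ≤
      -(∫ y, φ y ^ 2 * deriv (fun s => ∑ j, ‖divCurvature (A s) y (b j)‖ ^ 2) t) +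
        4 * K ^ 2 * (∫ y in U, ∑ j, ‖divCurvature (A t) y (b j)‖ ^ 2) +
        8 * Real.sqrt 2 * (Fintype.card ι : ℝ) * S *
          ∫ y, φ y ^ 2 * ∑ j, ‖divCurvature (A t) y (b j)‖ ^ 2 := by
  have hsm : ContDiff ℝ ∞ (A t) := contDiff_slice_of_contDiffOn_prod hA ht
  have hA22 : ContDiff ℝ (2 + 2) (A t) := by
    rw [show (2 : WithTop ℕ∞) + 2 = 4 by norm_num]; exact hsm.of_le (natCast_le_infty₁₁ 4)
  have hA32 : ContDiff ℝ (3 + 2) (A t) := by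
    rw [show (3 : WithTop ℕ∞) + 2 = 5 by norm_num]; exact hsm.of_le (natCast_le_infty₁₁ 5)
  have hA₄0 : 0 ≤ 8 * Real.sqrt 2 * (Fintype.card ι : ℝ) := by positivity
  -- ### continuity of the players
  have hD2 : ∀ j, ContDiff ℝ 2 fun z => divCurvature (A t) z (b j) := fun j =>
    contDiff_divCurvature_apply hA22 (b j)
  have hu2 : ContDiff ℝ 2 fun y => ∑ j, ‖divCurvature (A t) y (b j)‖ ^ 2 :=
    ContDiff.sum fun j _ => (hD2 j).norm_sq ℝ
  have huc : Continuous fun y => ∑ j, ‖divCurvature (A t) y (b j)‖ ^ 2 := hu2.continuous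
  have hHc : Continuous fun y => ∑ l, ∑ j,
      ‖covDeriv (A t) (fun z => divCurvature (A t) z (b j)) y (b l)‖ ^ 2 := by
    refine continuous_finsetSum _ fun l _ => continuous_finsetSum _ fun j _ => ?_
    have h21 : ContDiff ℝ (2 + 1) fun z => divCurvature (A t) z (b j) := by
      rw [show (2 : WithTop ℕ∞) + 1 = 3 by norm_num]; exact contDiff_divCurvature_apply hA32 (b j)
    exact ((contDiff_covDeriv_apply (hsm.of_le (natCast_le_infty₁₁ 2)) h21 (b l)).continuous).norm.pow 2
  have hu_joint : ContDiffOn ℝ ∞ (fun p : ℝ × E => ∑ j, ‖divCurvature (A p.1) p.2 (b j)‖ ^ 2)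
      (𝒯 ×ˢ (univ : Set E)) :=
    ContDiffOn.sum fun j _ => (contDiffOn_divCurvature_joint h𝒯 hA (b j)).norm_sq ℝ
  have hdec : Continuous fun y => deriv (fun s => ∑ j, ‖divCurvature (A s) y (b j)‖ ^ 2) t :=
    continuous_deriv_tslice_of_contDiffOn (q := fun s y => ∑ j, ‖divCurvature (A s) y (b j)‖ ^ 2)
      h𝒯 hu_joint ht
  have hlapc : Continuous fun y => ∑ l, fderiv ℝ (fun z => fderiv ℝ
      (fun x => ∑ j, ‖divCurvature (A t) x (b j)‖ ^ 2) z (b l)) y (b l) := by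
    refine continuous_finsetSum _ fun l _ => ?_
    have h1 : ContDiff ℝ 1 fun z => fderiv ℝ (fun x => ∑ j, ‖divCurvature (A t) x (b j)‖ ^ 2) z (b l) :=
      (hu2.fderiv_right (m := 1) (by norm_num)).clm_apply contDiff_const
    exact (h1.continuous_fderiv one_ne_zero).clm_apply continuous_const
  have hφcont : Continuous φ := hφ.continuous
  have hφ2c : Continuous fun y => φ y ^ 2 := hφcont.pow 2
  have hφ2s : HasCompactSupport fun y => φ y ^ 2 := hasCompactSupport_sq hφc
  have hu0 : ∀ y, 0 ≤ ∑ j, ‖divCurvature (A t) y (b j)‖ ^ 2 := fun y =>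
    Finset.sum_nonneg fun j _ => sq_nonneg _
  have he0 : ∀ y, 0 ≤ ymDensityOfBasis b (A t) y := fun y => ymDensityOfBasis_nonneg b _ y
  have hint : ∀ ⦃g : E → ℝ⦄, Continuous g → Integrable fun y => φ y ^ 2 * g y := fun g hg =>
    (hφ2c.mul hg).integrable_of_hasCompactSupport hφ2s.mul_right
  -- ### the pointwise inequality `φ² ∂ₜu ≤ φ² Δu − 2 φ² H + A₄ S φ² u`
  have hpt : ∀ y, φ y ^ 2 * deriv (fun s => ∑ j, ‖divCurvature (A s) y (b j)‖ ^ 2) t ≤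
      φ y ^ 2 * (∑ l, fderiv ℝ (fun z => fderiv ℝ
        (fun x => ∑ j, ‖divCurvature (A t) x (b j)‖ ^ 2) z (b l)) y (b l)) -
      2 * (φ y ^ 2 * ∑ l, ∑ j, ‖covDeriv (A t) (fun z => divCurvature (A t) z (b j)) y (b l)‖ ^ 2) +
        8 * Real.sqrt 2 * (Fintype.card ι : ℝ) * S *
          (φ y ^ 2 * ∑ j, ‖divCurvature (A t) y (b j)‖ ^ 2) := by
    intro y
    have hB := deriv_divDensity_sub_laplacian_le b h𝒯 hA hval hpde ht y
    have hφ2 : 0 ≤ φ y ^ 2 := sq_nonneg _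
    by_cases hφy : φ y = 0
    · simp [hφy]
    · have h3 : Real.sqrt (ymDensityOfBasis b (A t) y) * (∑ j, ‖divCurvature (A t) y (b j)‖ ^ 2) ≤
          S * ∑ j, ‖divCurvature (A t) y (b j)‖ ^ 2 :=
        mul_le_mul_of_nonneg_right (hS y hφy) (hu0 y)
      have h4 := mul_le_mul_of_nonneg_left hB hφ2
      have h5 := mul_le_mul_of_nonneg_left (mul_le_mul_of_nonneg_left h3 hA₄0) hφ2
      have hnn : 0 ≤ φ y ^ 2 * (2 * ∑ i, ∑ j,
          ‖covDeriv (A t) (fun z => divCurvature (A t) z (b j)) y (b i)‖ ^ 2) := by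
        refine mul_nonneg hφ2 (mul_nonneg zero_le_two ?_)
        exact Finset.sum_nonneg fun _ _ => Finset.sum_nonneg fun _ _ => sq_nonneg _
      linarith only [h4, h5, hnn]
  -- ### integrate
  have hi1 := hint hlapc
  have hi2 := hint hHc
  have hi3 : Integrable fun y => 8 * Real.sqrt 2 * (Fintype.card ι : ℝ) * S *
      (φ y ^ 2 * ∑ j, ‖divCurvature (A t) y (b j)‖ ^ 2) := (hint huc).const_mul _
  have hi2' : Integrable fun y => 2 * (φ y ^ 2 * ∑ l, ∑ j,
      ‖covDeriv (A t) (fun z => divCurvature (A t) z (b j)) y (b l)‖ ^ 2) := hi2.const_mul 2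
  have hi12 : Integrable fun y => φ y ^ 2 * (∑ l, fderiv ℝ (fun z => fderiv ℝ
      (fun x => ∑ j, ‖divCurvature (A t) x (b j)‖ ^ 2) z (b l)) y (b l)) -
      2 * (φ y ^ 2 * ∑ l, ∑ j, ‖covDeriv (A t) (fun z => divCurvature (A t) z (b j)) y (b l)‖ ^ 2) :=
    hi1.sub hi2'
  have hsum : Integrable fun y => φ y ^ 2 * (∑ l, fderiv ℝ (fun z => fderiv ℝ
      (fun x => ∑ j, ‖divCurvature (A t) x (b j)‖ ^ 2) z (b l)) y (b l)) -
      2 * (φ y ^ 2 * ∑ l, ∑ j, ‖covDeriv (A t) (fun z => divCurvature (A t) z (b j)) y (b l)‖ ^ 2) +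
      8 * Real.sqrt 2 * (Fintype.card ι : ℝ) * S *
        (φ y ^ 2 * ∑ j, ‖divCurvature (A t) y (b j)‖ ^ 2) := hi12.add hi3
  have hI1 := integral_mono (hint hdec) hsum hpt
  rw [integral_add hi12 hi3, integral_sub hi1 hi2', MeasureTheory.integral_const_mul,
    MeasureTheory.integral_const_mul] at hI1
  -- `∫ φ² Δu ≤ ∫ φ² H + 4 ∫ u ‖∇φ‖²`
  have hI2 := integral_sq_mul_laplacian_divDensity_le b hsm (hval ht) hφ hφc
  have hgradc : Continuous fun y => ‖fderiv ℝ φ y‖ ^ 2 :=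
    ((hφ.continuous_fderiv one_ne_zero).norm).pow 2
  have hgrads : HasCompactSupport fun y => ‖fderiv ℝ φ y‖ ^ 2 :=
    hasCompactSupport_norm_sq (hφc.fderiv (𝕜 := ℝ))
  have hig : Integrable fun y => (∑ j, ‖divCurvature (A t) y (b j)‖ ^ 2) * ‖fderiv ℝ φ y‖ ^ 2 :=
    (huc.mul hgradc).integrable_of_hasCompactSupport hgrads.mul_left
  have hI2' : (∫ y, φ y ^ 2 * ∑ l, fderiv ℝ (fun z => fderiv ℝ
      (fun x => ∑ j, ‖divCurvature (A t) x (b j)‖ ^ 2) z (b l)) y (b l)) ≤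
      (∫ y, φ y ^ 2 * ∑ l, ∑ j, ‖covDeriv (A t) (fun z => divCurvature (A t) z (b j)) y (b l)‖ ^ 2) +
        4 * ∫ y, (∑ j, ‖divCurvature (A t) y (b j)‖ ^ 2) * ‖fderiv ℝ φ y‖ ^ 2 := by
    have hi4 : Integrable fun y => 4 * (∑ j, ‖divCurvature (A t) y (b j)‖ ^ 2) * ‖fderiv ℝ φ y‖ ^ 2 := by
      have := hig.const_mul 4; simpa only [mul_assoc] using this
    have hsplit : (∫ y, (φ y ^ 2 * ∑ l, ∑ j,
        ‖covDeriv (A t) (fun z => divCurvature (A t) z (b j)) y (b l)‖ ^ 2 +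
        4 * (∑ j, ‖divCurvature (A t) y (b j)‖ ^ 2) * ‖fderiv ℝ φ y‖ ^ 2)) =
        (∫ y, φ y ^ 2 * ∑ l, ∑ j, ‖covDeriv (A t) (fun z => divCurvature (A t) z (b j)) y (b l)‖ ^ 2) +
          4 * ∫ y, (∑ j, ‖divCurvature (A t) y (b j)‖ ^ 2) * ‖fderiv ℝ φ y‖ ^ 2 := by
      rw [integral_add hi2 hi4, ← MeasureTheory.integral_const_mul]
      congr 1
      exact integral_congr_ae (ae_of_all _ fun y => by ring)
    rw [← hsplit]; exact hI2
  -- `∫ u ‖∇φ‖² ≤ K² ∫_U u`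
  have hI3 : (∫ y, (∑ j, ‖divCurvature (A t) y (b j)‖ ^ 2) * ‖fderiv ℝ φ y‖ ^ 2) ≤
      K ^ 2 * ∫ y in U, ∑ j, ‖divCurvature (A t) y (b j)‖ ^ 2 := by
    have hzero : ∀ y ∉ U, (∑ j, ‖divCurvature (A t) y (b j)‖ ^ 2) * ‖fderiv ℝ φ y‖ ^ 2 = 0 :=
      fun y hy => by rw [hφU y hy, norm_zero]; ring
    rw [← setIntegral_eq_integral_of_forall_compl_eq_zero hzero, ← integral_const_mul]
    refine setIntegral_mono_on hig.integrableOn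
      (((continuous_const.mul huc).continuousOn.integrableOn_compact hKc).mono_set hUK) hU
      fun y _ => ?_
    have h1 : ‖fderiv ℝ φ y‖ ^ 2 ≤ K ^ 2 := pow_le_pow_left₀ (norm_nonneg _) (hK y) 2
    calc (∑ j, ‖divCurvature (A t) y (b j)‖ ^ 2) * ‖fderiv ℝ φ y‖ ^ 2
        ≤ (∑ j, ‖divCurvature (A t) y (b j)‖ ^ 2) * K ^ 2 := mul_le_mul_of_nonneg_left h1 (hu0 y)
      _ = K ^ 2 * ∑ j, ‖divCurvature (A t) y (b j)‖ ^ 2 := mul_comm _ _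
  linarith only [hI1, hI2', hI3]

/-- **The localized space-time `L²` bound for `∇D^*F`.** Along a jointly smooth `𝔲(m)`-valued
solution of the Yang–Mills heat equation on the open time set `𝒯 ⊇ [t₁, t₂]`, for a `C¹`
compactly supported `φ` with `‖∇φ‖ ≤ K`, `∇φ = 0` off the measurable `U ⊆ K_c` (compact) and
`√e ≤ S` on `[t₁,t₂] × {φ ≠ 0}`: with `u = ∑‖𝒟ⱼ‖²`, `H = ∑‖D_l𝒟ⱼ‖²`, `A₄ = 8√2(card ι)`,
`∫_{t₁}^{t₂}∫ φ²H ≤ ∫ φ²u(t₁) + 4K² ∫_{t₁}^{t₂}∫_U u + A₄S ∫_{t₁}^{t₂}∫ φ²u`.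
[cite: Waldron2019, Prop. 3.1(b) (k = 1); Waldron2016, Lemma 3.5] -/
theorem intervalIntegral_integral_sq_mul_divGradDensity_le (b : OrthonormalBasis ι ℝ E)
    {A : ℝ → Connection E (Matrix m m ℂ)} {𝒯 : Set ℝ} (h𝒯 : IsOpen 𝒯)
    (hA : ContDiffOn ℝ ∞ (fun p : ℝ × E => A p.1 p.2) (𝒯 ×ˢ (univ : Set E)))
    (hval : ∀ ⦃s : ℝ⦄, s ∈ 𝒯 → (A s).IsValuedIn (skewAdjoint.submodule ℝ (Matrix m m ℂ)))
    (hpde : ∀ ⦃s : ℝ⦄, s ∈ 𝒯 → ∀ y w, deriv (fun s' => A s' y w) s = divCurvature (A s) y w)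
    {φ : E → ℝ} (hφ : ContDiff ℝ 1 φ) (hφc : HasCompactSupport φ)
    {Kc U : Set E} (hKc : IsCompact Kc) (hUK : U ⊆ Kc) (hU : MeasurableSet U)
    (hφU : ∀ y ∉ U, fderiv ℝ φ y = 0) {K : ℝ} (hK : ∀ y, ‖fderiv ℝ φ y‖ ≤ K)
    {t₁ t₂ : ℝ} (h12 : t₁ ≤ t₂) (hI : Icc t₁ t₂ ⊆ 𝒯) {S : ℝ}
    (hS : ∀ s ∈ Icc t₁ t₂, ∀ y, φ y ≠ 0 → Real.sqrt (ymDensityOfBasis b (A s) y) ≤ S) :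
    ∫ s in t₁..t₂, ∫ y, φ y ^ 2 * ∑ l, ∑ j,
        ‖covDeriv (A s) (fun z => divCurvature (A s) z (b j)) y (b l)‖ ^ 2 ≤
      (∫ y, φ y ^ 2 * ∑ j, ‖divCurvature (A t₁) y (b j)‖ ^ 2) +
        4 * K ^ 2 * (∫ s in t₁..t₂, ∫ y in U, ∑ j, ‖divCurvature (A s) y (b j)‖ ^ 2) +
        8 * Real.sqrt 2 * (Fintype.card ι : ℝ) * S *
          ∫ s in t₁..t₂, ∫ y, φ y ^ 2 * ∑ j, ‖divCurvature (A s) y (b j)‖ ^ 2 := by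
  have hφcont : Continuous φ := hφ.continuous
  have hφ2c : Continuous fun y => φ y ^ 2 := hφcont.pow 2
  have hφ2s : HasCompactSupport fun y => φ y ^ 2 := hasCompactSupport_sq hφc
  set A₄ : ℝ := 8 * Real.sqrt 2 * (Fintype.card ι : ℝ) with hA₄
  -- ### the slab-continuous integrands
  have hu_joint : ContDiffOn ℝ ∞ (fun p : ℝ × E => ∑ j, ‖divCurvature (A p.1) p.2 (b j)‖ ^ 2)
      (𝒯 ×ˢ (univ : Set E)) :=
    ContDiffOn.sum fun j _ => (contDiffOn_divCurvature_joint h𝒯 hA (b j)).norm_sq ℝ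
  have hu_c := hu_joint.continuousOn
  have hH_joint : ContDiffOn ℝ ∞ (fun p : ℝ × E => ∑ l, ∑ j,
      ‖covDeriv (A p.1) (fun z => divCurvature (A p.1) z (b j)) p.2 (b l)‖ ^ 2)
      (𝒯 ×ˢ (univ : Set E)) :=
    ContDiffOn.sum fun l _ => ContDiffOn.sum fun j _ =>
      (contDiffOn_covDeriv_divCurvature_joint h𝒯 hA (b j) (b l)).norm_sq ℝ
  have hH_c := hH_joint.continuousOn
  -- ### the time functions
  set Y : ℝ → ℝ := fun s => ∫ y, φ y ^ 2 * ∑ j, ‖divCurvature (A s) y (b j)‖ ^ 2 with hY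
  set D : ℝ → ℝ := fun s => ∫ y, φ y ^ 2 *
    deriv (fun s' => ∑ j, ‖divCurvature (A s') y (b j)‖ ^ 2) s with hD
  set G : ℝ → ℝ := fun s => ∫ y, φ y ^ 2 * ∑ l, ∑ j,
    ‖covDeriv (A s) (fun z => divCurvature (A s) z (b j)) y (b l)‖ ^ 2 with hG
  set EU : ℝ → ℝ := fun s => ∫ y in U, ∑ j, ‖divCurvature (A s) y (b j)‖ ^ 2 with hEU
  have hYc : ContinuousOn Y 𝒯 :=
    continuousOn_integral_mul_of_continuousOn_slab h𝒯 hu_c hφ2c hφ2s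
  have hGc : ContinuousOn G 𝒯 :=
    continuousOn_integral_mul_of_continuousOn_slab h𝒯 hH_c hφ2c hφ2s
  have hEUc : ContinuousOn EU 𝒯 :=
    continuousOn_setIntegral_of_continuousOn_slab h𝒯 hu_c hKc hUK hU
  have hO : IsOpen (𝒯 ×ˢ (univ : Set E)) := h𝒯.prod isOpen_univ
  set rate : ℝ × E → ℝ := fun p => fderiv ℝ
    (fun q : ℝ × E => ∑ j, ‖divCurvature (A q.1) q.2 (b j)‖ ^ 2) p ((1 : ℝ), (0 : E)) with hrate
  have hrate_c : ContinuousOn rate (𝒯 ×ˢ (univ : Set E)) :=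
    ((ContinuousLinearMap.apply ℝ ℝ ((1 : ℝ), (0 : E))).continuous.comp_continuousOn
      (hu_joint.continuousOn_fderiv_of_isOpen hO (by simp)))
  have hrate_eq : ∀ {s : ℝ}, s ∈ 𝒯 → ∀ y,
      deriv (fun s' => ∑ j, ‖divCurvature (A s') y (b j)‖ ^ 2) s = rate (s, y) := fun hs y =>
    (hasDerivAt_timeSlice hO hu_joint (by simp) ⟨hs, mem_univ y⟩).deriv
  have hDc : ContinuousOn D 𝒯 := by
    have h := continuousOn_integral_mul_of_continuousOn_slab h𝒯 hrate_c hφ2c hφ2s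
    refine h.congr fun s hs => ?_
    simp only [hD]
    exact integral_congr_ae (ae_of_all _ fun y => by simp only [hrate_eq hs y])
  have hYd : ∀ s ∈ 𝒯, HasDerivAt Y (D s) s := fun s hs =>
    hasDerivAt_integral_mul_of_contDiffOn
      (q := fun s y => ∑ j, ‖divCurvature (A s) y (b j)‖ ^ 2) h𝒯 hu_joint hφ2c hφ2s hs
  -- ### the fixed-time inequality on `[t₁, t₂]`
  have hfix : ∀ s ∈ Icc t₁ t₂, G s ≤ -D s + 4 * K ^ 2 * EU s + A₄ * S * Y s := fun s hs =>
    integral_sq_mul_divGradDensity_le_of_flow_on b h𝒯 hA hval hpde hφ hφc hKc hUK hU hφU hK (hI hs)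
      (hS s hs)
  -- ### integrate in time
  have hIi : ∀ ⦃f : ℝ → ℝ⦄, ContinuousOn f 𝒯 → IntervalIntegrable f volume t₁ t₂ := fun f hf =>
    ContinuousOn.intervalIntegrable (by rw [uIcc_of_le h12]; exact hf.mono hI)
  have hGi := hIi hGc
  have hDi := hIi hDc
  have hEUi := hIi hEUc
  have hYi := hIi hYc
  have hDn : IntervalIntegrable (fun s => -D s) volume t₁ t₂ := hDi.neg
  have hDE : IntervalIntegrable (fun s => -D s + 4 * K ^ 2 * EU s) volume t₁ t₂ :=
    hDn.add (hEUi.const_mul (4 * K ^ 2))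
  have hRi : IntervalIntegrable (fun s => -D s + 4 * K ^ 2 * EU s + A₄ * S * Y s) volume t₁ t₂ :=
    hDE.add (hYi.const_mul (A₄ * S))
  have hmono := intervalIntegral.integral_mono_on h12 hGi hRi hfix
  have hsplit : (∫ s in t₁..t₂, (-D s + 4 * K ^ 2 * EU s + A₄ * S * Y s)) =
      -(∫ s in t₁..t₂, D s) + 4 * K ^ 2 * (∫ s in t₁..t₂, EU s) + A₄ * S * ∫ s in t₁..t₂, Y s := by
    rw [intervalIntegral.integral_add hDE (hYi.const_mul (A₄ * S)),
      intervalIntegral.integral_add hDn (hEUi.const_mul (4 * K ^ 2)),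
      intervalIntegral.integral_neg, intervalIntegral.integral_const_mul,
      intervalIntegral.integral_const_mul]
  have hFTC : (∫ s in t₁..t₂, D s) = Y t₂ - Y t₁ :=
    intervalIntegral.integral_eq_sub_of_hasDerivAt
      (fun s hs => hYd s (hI (by rwa [uIcc_of_le h12] at hs))) hDi
  have hY2 : 0 ≤ Y t₂ := integral_nonneg fun y => mul_nonneg (sq_nonneg _)
    (Finset.sum_nonneg fun j _ => sq_nonneg _)
  rw [hsplit, hFTC] at hmono
  simp only [hG, hY, hEU] at hmono ⊢
  linarith only [hmono, hY2]

end DivGradEnergy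

end Literature.MathematicalPhysics.QuantumLattice
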